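import Literature.Computability.AlgebraicComplexity.ConstituentStageStructure
import Literature.Computability.AlgebraicComplexity.MoreAsymHashedZeroOut
import Literature.Computability.AlgebraicComplexity.ConstituentYCompatibility
import HarnessLib

/-!
# The structure of the more asymmetric constituent stage: after hashing (`X`-blocks unique) and the
zero-outs of §6.3–§6.5 the input is a direct sum of broken copies of `𝒯*` with holes of three kinds
(Alman–Duan–Vassilevska Williams–Xu–Xu–Zhou 2025, §6.2–§6.5) — proved

Topic `Literature/Computability/AlgebraicComplexity`.  This file instantiates the abstract more asymmetric
hashed-stage structure (`MoreAsymHashedZeroOut.lean`) with the data of one region of the constituent stage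
of Alman–Duan–Vassilevska Williams–Xu–Xu–Zhou, *More asymmetry yields faster matrix multiplication* (SODA
2025, arXiv:2404.16349), §6.2–§6.5, on the half-chunk positions of a level-`ℓ` `ε`-interface tensor
`𝒯_{τ,L,ε}` — the data are VXXZ's (`ConstituentStageData.lean`, `ConstituentRegion` of
`ConstituentStageStructure.lean`: term map `τ`, terms `L`, tolerance `ε`, pair counts `k_W`, `{α_t}` counts
`cnt`, level-`(ℓ−1)` split distributions `β_{W,t,i',j',k'}`, buckets `B`), the skeleton is ADVXXZ's:

* `ConstituentRegion.toMoreAsymHashed` — universe = the remaining level-`(ℓ−1)` triples, distinguished =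
  the `{α_t}`-consistent ones, usefulness = Defs. 6.10/6.13 (`IsUsefulFor₂`), `Y`-compatibility = **Def. 6.8**
  (`IsYCompatibleWith₂`, `ConstituentYCompatibility.lean`), `Z`-compatibility = Def. 6.11 (`IsCompatibleWith₂`),
  ambient admitted sequences = those merging to level-1 blocks of the input;
* `ConstituentRegion.MoreAsymWellFormed`, `moreAsymWellFormed` — **the hypotheses of the abstract structure
  theorem hold**, given Remark 6.1's conventions (VXXZ's two and `β_{Y,t,i',j',0}(L) = β_{X,t,i',j',0}(2⃗ − L)`):
  closedness, useful ⇒ `Y`-compatible (`IsUsefulFor₂.isYCompatibleWith₂`), useful ⇒ `Z`-compatible,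
  **Claim 6.9** (`yCompatible_fst_of_usefulX₂`) and **Claim 6.12** (`compatible_fst_of_useful₂`);
* `usefulSub_eq_starTensor₂'` — the useful sub-tensor over a triple of the universe IS `𝒯*` (`starTensor₂`);
* `summand_eq_brokenStar₂` — **the summand of `𝒯_ZUseful` over a triple `T` of `𝒯_hash` is `𝒯*_T` with the
  hole sets `firstTypeHolesX`, `firstTypeHolesY ∪ holesY T` and `firstTypeHolesZ ∪ holesZ T`** (§6.5: "The
  three types of holes are the followings: [the input does not include all level-1 blocks]; the holes on
  `Y`-blocks caused by `Y`-compatibility zero-outs; the holes on `Z`-blocks caused by `Z`-compatibility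
  zero-outs"), and `input_restrictsTo_directSum₂` — **the input `𝒯_{τ,L,ε}` (read on half-chunks) restricts to
  the direct sum of these broken copies over the triples of `𝒯_hash`**.

Everything is proved; the definitions are `toMoreAsymHashed` and `MoreAsymWellFormed`; no named facts.

## References

* J. Alman, R. Duan, V. Vassilevska Williams, Y. Xu, Z. Xu, R. Zhou, *More asymmetry yields faster
  matrix multiplication*, SODA 2025, arXiv:2404.16349 (held: `paper:arxiv-2404.16349`, chunks
  p0023–p0025): §6.2 (𝒯_hash), §6.3 (Def. 6.8, Claim 6.9, Def. 6.10), §6.4 (Def. 6.11, Claim 6.12,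
  Def. 6.13), §6.5 (𝒯*, the three kinds of holes), Remark 6.1. [AlmanDuanVassilevskaWilliamsXuXuZhou2025]
* V. Vassilevska Williams, Y. Xu, Z. Xu, R. Zhou, *New bounds for matrix multiplication: from alpha
  to omega*, SODA 2024, arXiv:2307.07970, §6.2–§6.5 (the data and the `Z`-dimension notions).
  [VassilevskaWilliamsXuXuZhou2024]
-/

noncomputable section

open scoped BigOperators
open Finset

namespace Literature.Computability.AlgebraicComplexity

open Literature.Barriers.MatrixMultiplication (bigCwTensor)

universe u

namespace ConstituentRegion

open scoped Classical

variable {c n s M : ℕ} (D : ConstituentRegion c n s M)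

/-- **The constituent stage as a more asymmetric hashed stage**: VXXZ's hashed-stage data of the region
(`toHashed`: universe, `{α_t}`-consistent triples, buckets, usefulness, `Z`-compatibility, admitted
sequences) together with the `Y`-compatibility of Def. 6.8. [cite: AlmanDuanVassilevskaWilliamsXuXuZhou2025, §6.2–§6.5] -/
def toMoreAsymHashed : MoreAsymHashedZeroOut c (n + n) M where
  toHashedZeroOut := D.toHashed
  CY := fun T Jh => IsYCompatibleWith₂ D.τ D.L (fun t ijk => (D.cnt t ijk : ℝ)) D.βY (seqVal T.1) (seqVal T.2.1) (seqVal T.2.2) Jh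

/-- The underlying hashed-stage data. [folklore] -/
@[simp] theorem toMoreAsymHashed_toHashedZeroOut : D.toMoreAsymHashed.toHashedZeroOut = D.toHashed := rfl

/-- The `Y`-compatibility of the stage is Def. 6.8. [folklore] -/
theorem toMoreAsymHashed_CY (T : (Fin (n + n) → Fin (2 * c + 1)) × (Fin (n + n) → Fin (2 * c + 1)) × (Fin (n + n) → Fin (2 * c + 1)))
    (Jh : Fin (n + n) → Fin c → Fin 3) :
    D.toMoreAsymHashed.CY T Jh =
      IsYCompatibleWith₂ D.τ D.L (fun t ijk => (D.cnt t ijk : ℝ)) D.βY (seqVal T.1) (seqVal T.2.1) (seqVal T.2.2) Jh := rfl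

/-- **The standing hypotheses on the data for the more asymmetric stage**: VXXZ's (`WellFormed`: supports of
the pair counts, Remark 6.1 for `β_Z`) and Remark 6.1's third convention `β_{Y,t,i',j',0}(L) = β_{X,t,i',j',0}(2⃗ − L)`
("The same holds between `β_{X,t}` and `β_{Y,t}` when `k_t = 0`"). [cite: AlmanDuanVassilevskaWilliamsXuXuZhou2025, Remark 6.1] -/
structure MoreAsymWellFormed : Prop extends D.WellFormed where
  /-- Remark 6.1: `β_{Y,t,i',j',0}(L) = β_{X,t,i',j',0}(2⃗ − L)` -/
  revXY : ∀ t i j σ, D.βY t (i, j, 0) σ = D.βX t (i, j, 0) (fun r => (σ r).rev)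

variable {D}

/-- Triples of `𝒯_hash` are level triples (inside the level-`ℓ` blocks). [cite: AlmanDuanVassilevskaWilliamsXuXuZhou2025, §6.2] -/
theorem present_isLevelTriple₂ (hD : D.WellFormed) {ω : VxxzSeed M (n + n)} (T : ↥(D.toMoreAsymHashed.present ω)) :
    IsLevelTriple c (seqVal T.1.1) (seqVal T.1.2.1) (seqVal T.1.2.2) :=
  (tripleSet_good hD (filter_subset _ _ (xPresentTriples_subset T.2) : T.1 ∈ D.tripleSet)).1

/-- **The more asymmetric constituent stage satisfies the hypotheses of the abstract structure theorem.**
[cite: AlmanDuanVassilevskaWilliamsXuXuZhou2025, §6.3–§6.5 (Def. 6.8, Claim 6.9, Def. 6.10, Def. 6.11, Claim 6.12, Def. 6.13)] -/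
theorem moreAsymWellFormed (hD : D.MoreAsymWellFormed) : D.toMoreAsymHashed.WellFormed where
  subset := by
    show D.consistent ⊆ D.tripleSet
    exact filter_subset _ _
  closed := by
    intro T₁ hT₁ T₂ hT₂ T₃ hT₃ T₀ h1 h2 h3 hlev
    change T₁ ∈ D.tripleSet at hT₁
    change T₂ ∈ D.tripleSet at hT₂
    change T₃ ∈ D.tripleSet at hT₃
    change T₀ ∈ D.tripleSet
    rw [mem_tripleUniverse] at hT₁ hT₂ hT₃ ⊢
    exact ⟨⟨h1 ▸ hT₁.1.1, h2 ▸ hT₂.1.2.1, h3 ▸ hT₃.1.2.2⟩, fun p => hlev p⟩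
  usefulCompatibleY := by
    intro T hT Jh hu
    change T ∈ D.consistent at hT
    obtain ⟨hTu, hcnt⟩ := mem_filter.1 hT
    obtain ⟨hlev, hI, hJ, hK⟩ := tripleSet_good hD.toWellFormed hTu
    exact IsUsefulFor₂.isYCompatibleWith₂ D.τ D.L hlev hI hJ hK hcnt hu
  usefulCompatibleZ := by
    intro T hT Kh hu
    change T ∈ D.consistent at hT
    obtain ⟨hTu, hcnt⟩ := mem_filter.1 hT
    obtain ⟨hlev, hI, hJ, hK⟩ := tripleSet_good hD.toWellFormed hTu
    exact IsUsefulFor₂.isCompatibleWith₂ D.τ D.L hlev hI hJ hK hcnt hu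
  claim57 := by
    intro Ih Jh Kh hsum hT₀ huX T₂ hT₂ h2 huY
    change T₂ ∈ D.consistent at hT₂
    refine ⟨fun t i j k hk hne => ?_, ?_⟩
    · exact yCompatible_fst_of_usefulX₂ D.τ hD.revXY hsum huX t i j k hk hne
    · -- typicality from the usefulness for `T₂ ∈ 𝒯α` through `Y_J`
      obtain ⟨hT₂u, hcnt⟩ := mem_filter.1 hT₂
      obtain ⟨hlev, hI, hJ, hK⟩ := tripleSet_good hD.toWellFormed hT₂u
      have htyp := IsUsefulFor₂.isTypicalY₂ D.τ D.L hlev hI hJ hK hcnt huY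
      rw [h2] at htyp
      exact htyp
  claim510 := by
    intro Ih Jh Kh hsum hT₀ huX huY T₃ hT₃ h3 huZ
    change T₃ ∈ D.consistent at hT₃
    refine ⟨fun t i j k hij hne => ?_, ?_⟩
    · exact compatible_fst_of_useful₂ D.τ hD.revX hD.revY hsum huX huY t i j k hij hne
    · obtain ⟨hT₃u, hcnt⟩ := mem_filter.1 hT₃
      obtain ⟨hlev, hI, hJ, hK⟩ := tripleSet_good hD.toWellFormed hT₃u
      have htyp := IsUsefulFor₂.isTypical₂ D.τ D.L hlev hI hJ hK hcnt huZ
      rw [h3] at htyp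
      exact htyp

/-! ### The summands are broken copies of `𝒯*` -/

variable (R : Type u) [CommSemiring R] (q : ℕ)

/-- **The useful sub-tensor over a triple of the universe is `𝒯*`.** [cite: AlmanDuanVassilevskaWilliamsXuXuZhou2025, §6.5 (𝒯*)] -/
theorem usefulSub_eq_starTensor₂'
    {T : (Fin (n + n) → Fin (2 * c + 1)) × (Fin (n + n) → Fin (2 * c + 1)) × (Fin (n + n) → Fin (2 * c + 1))}
    (h : IsLevelTriple c (seqVal T.1) (seqVal T.2.1) (seqVal T.2.2)) :
    D.toMoreAsymHashed.usefulSub R q T = starTensor₂ D.τ R q h D.βX D.βY D.βZ := by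
  rw [MoreAsymHashedZeroOut.usefulSub, starTensor₂, interfaceTensor]
  congr 1
  · ext Ih
    rw [mem_filter, mem_levelBlocksX_pair_iff D.τ h, chunkLevels_eq_iff]
    simp [toMoreAsymHashed, toHashed]
  · ext Jh
    rw [mem_filter, mem_levelBlocksY_pair_iff D.τ h, chunkLevels_eq_iff]
    simp [toMoreAsymHashed, toHashed]
  · ext Kh
    rw [mem_filter, mem_levelBlocksZ_pair_iff D.τ h, chunkLevels_eq_iff]
    simp [toMoreAsymHashed, toHashed]

/-- **The summand over a triple of `𝒯_hash` is a broken copy of `𝒯*` with holes of the three kinds**: `𝒯*_T`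
with the level-1 `X`-blocks `firstTypeHolesX`, the `Y`-blocks `firstTypeHolesY ∪ holesY T` and the `Z`-blocks
`firstTypeHolesZ ∪ holesZ T` zeroed out. [cite: AlmanDuanVassilevskaWilliamsXuXuZhou2025, §6.5 ("The three types of holes")] -/
theorem summand_eq_brokenStar₂ (hD : D.MoreAsymWellFormed) {ω : VxxzSeed M (n + n)} (T : ↥(D.toMoreAsymHashed.present ω))
    (h : IsLevelTriple c (seqVal T.1.1) (seqVal T.1.2.1) (seqVal T.1.2.2)) :
    D.toMoreAsymHashed.summand R q ω T =
      partSubtensor levelSeq levelSeq levelSeq (starTensor₂ D.τ R q h D.βX D.βY D.βZ)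
        (firstTypeHolesX D.τ D.L D.ε h D.βX D.βY D.βZ)ᶜ
        (firstTypeHolesY D.τ D.L D.ε h D.βX D.βY D.βZ ∪ D.toMoreAsymHashed.holesY ω T.1)ᶜ
        (firstTypeHolesZ D.τ D.L D.ε h D.βX D.βY D.βZ ∪ D.toMoreAsymHashed.holesZ ω T.1)ᶜ := by
  rw [MoreAsymHashedZeroOut.summand_eq_brokenCopy (moreAsymWellFormed hD) R q T, usefulSub_eq_starTensor₂' R q h, starTensor₂,
    interfaceTensor]
  refine partSubtensor_partSubtensor_congr R _ _ _ _ _ _ _ (fun Ih hIh => ?_) (fun Jh hJh => ?_) (fun Kh hKh => ?_)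
  · simp only [toMoreAsymHashed, toHashed, mem_admX, firstTypeHolesX, mem_compl, mem_filter, not_and, not_not]
    exact ⟨fun hm _ => hm, fun hm => hm hIh⟩
  · simp only [toMoreAsymHashed, toHashed, mem_admY, firstTypeHolesY, mem_compl, mem_union, mem_sdiff, mem_filter, not_or,
      not_and, not_not]
    constructor
    · rintro ⟨hm, hnot⟩; exact ⟨fun _ => hm, hnot⟩
    · rintro ⟨hm, hnot⟩; exact ⟨hm hJh, hnot⟩
  · simp only [toMoreAsymHashed, toHashed, mem_admZ, firstTypeHolesZ, mem_compl, mem_union, mem_sdiff, mem_filter, not_or,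
      not_and, not_not]
    constructor
    · rintro ⟨hm, hnot⟩; exact ⟨fun _ => hm, hnot⟩
    · rintro ⟨hm, hnot⟩; exact ⟨hm hKh, hnot⟩

/-- **The input restricts to the final tensor `𝒯_ZUseful` of the stage** (all the zero-outs of §6.2–§6.5
applied to the input read on half-chunks are zero-outs). [cite: AlmanDuanVassilevskaWilliamsXuXuZhou2025, §6.2–§6.5] -/
theorem inputOnHalves_restrictsTo_finalTensor₂ (ω : VxxzSeed M (n + n)) :
    TensorRestrictsTo (inputOnHalves R q D.τ D.L D.ε) (D.toMoreAsymHashed.finalTensor R q ω) := by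
  have e : D.toMoreAsymHashed.finalTensor R q ω = partSubtensor levelSeq levelSeq levelSeq (inputOnHalves R q D.τ D.L D.ε)
      (univ.filter (D.toMoreAsymHashed.keepX ω)) (univ.filter (D.toMoreAsymHashed.keepY ω))
      (univ.filter (D.toMoreAsymHashed.keepZ ω)) := by
    have hin : inputOnHalves R q D.τ D.L D.ε = partSubtensor levelSeq levelSeq levelSeq
        (kroneckerPow (kroneckerPow (bigCwTensor R q) c) (n + n)) D.admX D.admY D.admZ := by
      funext x y z
      rw [inputOnHalves, interfaceTensor, partSubtensor_apply, partSubtensor_apply, kroneckerPow_bigCw_mergeHalves]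
      simp only [mem_admX, mem_admY, mem_admZ, levelSeq_mergeHalves]
    rw [hin, partSubtensor_partSubtensor, MoreAsymHashedZeroOut.finalTensor]
    congr 1
    · ext Ih; simp only [mem_inter, mem_filter, mem_univ, true_and]
      exact ⟨fun hk => ⟨hk.1, hk⟩, fun hk => hk.2⟩
    · ext Jh; simp only [mem_inter, mem_filter, mem_univ, true_and]
      exact ⟨fun hk => ⟨hk.1, hk⟩, fun hk => hk.2⟩
    · ext Kh; simp only [mem_inter, mem_filter, mem_univ, true_and]
      exact ⟨fun hk => ⟨hk.1, hk⟩, fun hk => hk.2⟩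
  rw [e]
  exact tensorRestrictsTo_partSubtensor _ _ _ _ _ _ _

/-- **The input `ε`-interface tensor restricts to the direct sum, over the triples of `𝒯_hash`, of the broken
copies of `𝒯*`.** [cite: AlmanDuanVassilevskaWilliamsXuXuZhou2025, §6.5 ("we want to ensure that the subtensor of 𝒯_ZUseful restricted to each level-(ℓ−1) block triple X_I Y_J Z_K is isomorphic to 𝒯* … there are some holes")] -/
theorem input_restrictsTo_directSum₂ (hD : D.MoreAsymWellFormed) (ω : VxxzSeed M (n + n)) :
    TensorRestrictsTo (interfaceTensor R q D.τ D.L D.ε)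
      (familyDirectSum fun T : ↥(D.toMoreAsymHashed.present ω) => D.toMoreAsymHashed.summand R q ω T) :=
  ((tensorRestrictsTo_inputOnHalves R q D.τ D.L D.ε).trans (inputOnHalves_restrictsTo_finalTensor₂ R q ω)).trans
    (MoreAsymHashedZeroOut.finalTensor_restrictsTo_directSum (moreAsymWellFormed hD) R q ω)

end ConstituentRegion

end Literature.Computability.AlgebraicComplexity
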